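import Summits.CriticalPhenomena.SAWScalingLimit.Theses.SAWChargeContinuation

/-!
# `TargetOfConjuncts` for route SAWChargeContinuation (item stmt-CriticalPhenomena-14196)

Pure bookkeeping: the route's `Target` is, after zeta/delta-reduction of the inlined lets
`hull` / `pb` / `carrier`, literally the conjunction
`SAWAvoidanceLaw ∧ EventualTight ∧ SubseqSimple`, so the three conjuncts assemble it by `And.intro`.
-/

namespace Summit.CriticalPhenomena.SAWScalingLimit.Theorems

open Summit.CriticalPhenomena.SAWScalingLimit.Theses.SAWChargeContinuation

/-- Item stmt-CriticalPhenomena-14196 (`TargetOfConjuncts`, support of route SAWChargeContinuation):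
the Target `X = (A0) ∧ (T) ∧ (S)` follows from its three conjuncts `SAWAvoidanceLaw` (A0),
`EventualTight` (T) and `SubseqSimple` (S). The three route definitions are definitionally the three
conjuncts of `Target` (the shared `let`s `hull`, `pb`, `carrier` reduce by zeta), so the proof is
`And.intro`. -/
theorem targetOfConjuncts_proof : TargetOfConjuncts := by
  unfold TargetOfConjuncts
  intro h₁ h₂ h₃
  exact ⟨h₁, h₂, h₃⟩

end Summit.CriticalPhenomena.SAWScalingLimit.Theorems
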